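import Summits.NavierStokesRegularity.NavierStokesRegularity.Theorems.ScenarioCensusRowF1ax
import Summits.NavierStokesRegularity.NavierStokesRegularity.Theorems.ScenarioCensusRowA7h
import Summits.NavierStokesRegularity.NavierStokesRegularity.Theorems.DssFarFieldSlavingBlowupTypeIDssProfileSimilarityEnstrophyBeltramiLiouville
import Summits.NavierStokesRegularity.NavierStokesRegularity.Theorems.SqueezeCycleSingularZoomWindow
import Summits.NavierStokesRegularity.NavierStokesRegularity.Theorems.ClockStretchingLawClockCeilingZoomDerivLimit
import Summits.NavierStokesRegularity.NavierStokesRegularity.Theorems.PoloidalWindowDoorPoloidalWindowRigidityVorticityTranslate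
import Summits.NavierStokesRegularity.NavierStokesRegularity.Theorems.HalfSpaceWindowDoorCirculationCarryingRigidityWholeSpaceMaxPrinciple
import Literature.Analysis.FluidPDE.TypeIAncientMild
import Literature.Analysis.FluidPDE.WholeSpaceIBP
import Literature.Analysis.FluidPDE.ClassicalSolutionCalculus
import Literature.Analysis.FluidPDE.VorticityEquation
import Literature.Analysis.FluidPDE.TypeIAncientMildClassical
import Summits.NavierStokesRegularity.NavierStokesRegularity.Theorems.DssFarFieldSlavingBlowupTypeIDssProfileSimilarityEnstrophyCrossFlowNoDecayOne
import Summits.NavierStokesRegularity.NavierStokesRegularity.Theorems.DssFarFieldSlavingBlowupTypeIDssProfileSimilarityEnstrophyTimeOnlyThreshold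
import HarnessLib
import Summits.NavierStokesRegularity.NavierStokesRegularity.Theorems.ScenarioCensusRowF1IntStretchBudget

/-!
# Census row F1, family «LIOUVILLE SOCKET» (cells F1sp / F1xf / F1vol; floors DSE / DXE / DFV) — LINE 27 «liouville-socket» port, part 1/5: §1 levels, the sharp Type-I constant,
# the third-order datum; §2 calculus of zooms up to third order (shared lemmas BY NAME from the landed ports); §3 the singular Type-I zoom package (BY NAME); §4 fast
# points of the zoom and the upgrade of a closed scale-invariant sign condition; §5 measurable zoom charts, scale covariance of
# space–time volume, measurability of the top (BY NAME), the integral transfer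

Re-homed for the scenario census (typer seat ns-census-typer-1 g9; the cells F1sp / F1vol / F1xf and the floors DSE / DFV / DXE are MEMBERS OF RECORD «DECIDED IN KERNEL IN
FILES» of row F1 since census v1.80 (critic idea-crit-3 g8 PASS — no price; ref ns-census-ref g11 PRE-CHECK ✓ §16.2 item 48; lead-presearch label); this port makes them
TREE-decided): VERBATIM PORT of ns-idea-3 LINE 27 «liouville-socket», `pub/ideators/ns-idea-3/lines/liouville-socket/line-liouville-socket.lean` sha16 01bcb6dd501a8321
(1929 l., lean check rc 0, 0 sorry), split for the 400-line rule into five parts `ScenarioCensusRowF1Socket{∅, Readout, Kill, Rows, Top}` (chain imports).  Lean text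
VERBATIM in namespace `…Theorems.ScenarioCensus.LiouvilleSocket` (the line's `…Cruxes.ScenarioCensusRowF1.LiouvilleSocketLine` re-homed); port edits: the bracket lines
`section …` / `end …` dropped (no `variable`s), `@[conjecture]` on the residual `SocketSlack` (≡ `ScenarioCensus.Row_F1`, OPEN), one-line docstrings added where missing
(gate lint); lemmas the line shares VERBATIM with the landed inviscid-top / frozen-top / columnar-top / stretched-top / integrated-stretch ports are taken BY NAME (listed
below).  Statements untouched.

No census VALUE is moved here (row F1 stays OPEN-WITH-LINE; the members become TREE-decided by name); NS regularity is NOT proved; `Row_F1` is untouched (zero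
movement, `socketSlack_iff_rowF1`); no summit statement is proved by this file. Lemmas that restate already-landed tree declarations are taken BY NAME (gate lint `dedup.landed`): `fderiv_smul_stPull_apply` = `InviscidTop.fderiv_smul_stPull_apply`, `fderiv_smul_stPull` = `InviscidTop.fderiv_smul_stPull`, `fderiv_fderiv_smul_stPull` = `InviscidTop.fderiv_fderiv_smul_stPull`, `tendsto_clm_of_tendsto_apply` = `InviscidTop.tendsto_clm_of_tendsto_apply`, `tendsto_fderiv_fderiv_apply_of_bound` = `InviscidTop.tendsto_fderiv_fderiv_apply_of_bound`, `tendsto_fderiv_fderiv_of_bound` = `InviscidTop.tendsto_fderiv_fderiv_of_bound`, `tendsto_fderiv_fderiv_of_typeI_seq_Ioo` = `InviscidTop.tendsto_fderiv_fderiv_of_typeI_seq_Ioo`, `fderiv3_smul_stPull` = `FrozenTop.fderiv3_smul_stPull`, `tendsto_fderiv3_of_typeI_seq_Ioo` = `FrozenTop.tendsto_fderiv3_of_typeI_seq_Ioo`, `tendsto_physicalTime` = `ColumnarTop.tendsto_physicalTime`, `eventually_fast` = `ColumnarTop.eventually_fast`, `sqrt_timeLag` = `StretchedTop.sqrt_timeLag`,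 `forall_of_forall_ne_zero` = `StretchedTop.forall_of_forall_ne_zero`, `radius_eq` = `FrozenTop.radius_eq`, `jointCond_everywhere₆` = `FrozenTop.jointCond_everywhere₄`, `continuousOn_quad` = `IntegratedStretch.continuousOn_quad`, `sqrt_nu_timeLag` = `IntegratedStretch.sqrt_nu_timeLag`, `sing_of_not_bounded` = `InviscidTop.sing_of_not_bounded`, `exists_singularZoom_package₃` = `FrozenTop.exists_singularZoom_package₃`, `lapD_eq_zero_of_eq_zero` = `FrozenTop.lapD_eq_zero_of_eq_zero`, `measurableSet_top` = `IntegratedStretch.measurableSet_top`.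
-/

-- the summit and its single problem share the name `NavierStokesRegularity` (D-0017 nested layout)
set_option linter.dupNamespace false

noncomputable section

open MeasureTheory Set Function Filter TopologicalSpace Metric
open scoped Topology NNReal ENNReal InnerProductSpace RealInnerProductSpace Laplacian

namespace Summit.NavierStokesRegularity.NavierStokesRegularity.Theorems.ScenarioCensus.LiouvilleSocket

open Literature.Analysis Literature.Analysis.FluidPDE
open Summit.NavierStokesRegularity.NavierStokesRegularity.Theorems

/-- `ℝ³`. -/
abbrev E3 := EuclideanSpace ℝ (Fin 3)

/-- The space of Hessians `D²v(x) : ℝ³ →L (ℝ³ →L ℝ³)`. -/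
abbrev Hess := E3 →L[ℝ] E3 →L[ℝ] E3

/-- The coordinate unit vectors. -/
abbrev eI (i : Fin 3) : E3 := EuclideanSpace.single i (1 : ℝ)
/-! ## §1 Levels, the dimensionless Type-I constant, the third-order datum `K = Σᵢ D³v(eᵢ,eᵢ,·)` (frame of LINES 18–26,
re-proved verbatim) -/

/-- **Subcritical (moving) speed level**: `Λ(t) √(T − t) → 0` as `t ↑ T`. -/
def IsSubcriticalLevel (T : ℝ) (Λ : ℝ → ℝ) : Prop :=
  Tendsto (fun t => Λ t * Real.sqrt (T - t)) (𝓝[<] T) (𝓝 0)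

/-- **Type-I blow-up with dimensionless constant `M`**: eventually `√(T − t) ‖u(t, x)‖ ≤ M √ν`. -/
def IsTypeIBlowupWith (M ν : ℝ) (u : ℝ → E3 → E3) (T : ℝ) : Prop :=
  ∀ᶠ t in 𝓝[<] T, ∀ x : E3, Real.sqrt (T - t) * ‖u t x‖ ≤ M * Real.sqrt ν

/-- **Third-order datum**: the trace `Σᵢ D³v(x) eᵢ eᵢ ∈ L(ℝ³)` of the third derivative in its two outer slots
(for smooth `v` this is `D(Δv)(x)`; only the trace of `D³v` enters the vorticity equation). -/
def lapD (v : E3 → E3) (x : E3) : E3 →L[ℝ] E3 := ∑ i, fderiv ℝ (fderiv ℝ (fderiv ℝ v)) x (eI i) (eI i)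
/-! ### Constant levels; the sharp Type-I constant of a Type-I blow-up -/

/-- Constant levels are subcritical. -/
theorem isSubcriticalLevel_const (T Λ : ℝ) : IsSubcriticalLevel T (fun _ => Λ) := by
  have h : Tendsto (fun t : ℝ => Λ * Real.sqrt (T - t)) (𝓝 T) (𝓝 (Λ * Real.sqrt (T - T))) :=
    ((continuous_const.sub continuous_id).sqrt.tendsto T).const_mul Λ
  rw [sub_self, Real.sqrt_zero, mul_zero] at h
  exact h.mono_left nhdsWithin_le_nhds

/-- A dimensionless Type-I bound is a Type-I bound. -/
theorem IsTypeIBlowupWith.isTypeIBlowup {M ν T : ℝ} {u : ℝ → E3 → E3} (h : IsTypeIBlowupWith M ν u T) :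
    IsTypeIBlowup u T := by
  refine ⟨M * Real.sqrt ν, ?_⟩
  filter_upwards [h, self_mem_nhdsWithin] with t ht htT x
  have htT' : t < T := htT
  have hs : 0 < Real.sqrt (T - t) := Real.sqrt_pos.2 (sub_pos.2 htT')
  rw [le_div_iff₀ hs, mul_comm]
  exact ht x

/-- Every Type-I blow-up has a dimensionless constant (`M = C/√ν`). -/
theorem exists_isTypeIBlowupWith {ν T : ℝ} (hν : 0 < ν) {u : ℝ → E3 → E3} (h : IsTypeIBlowup u T) :
    ∃ M : ℝ, IsTypeIBlowupWith M ν u T := by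
  obtain ⟨C, hC⟩ := h
  refine ⟨C / Real.sqrt ν, ?_⟩
  have hsν : 0 < Real.sqrt ν := Real.sqrt_pos.2 hν
  filter_upwards [hC, self_mem_nhdsWithin] with t ht htT x
  have htT' : t < T := htT
  have hs : 0 < Real.sqrt (T - t) := Real.sqrt_pos.2 (sub_pos.2 htT')
  rw [div_mul_cancel₀ C hsν.ne']
  have h1 := ht x
  rw [le_div_iff₀ hs] at h1
  rw [mul_comm]
  exact h1

/-! ## §2 Calculus of zooms up to third order; the `C²_loc` tool (LINE 18) and the `C³_loc` tool (LINE 20), re-proved verbatim -/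

-- `fderiv_smul_stPull_apply`: the line restates the tree's `InviscidTop.fderiv_smul_stPull_apply`; taken BY NAME (gate lint dedup.landed).

-- `fderiv_smul_stPull`: the line restates the tree's `InviscidTop.fderiv_smul_stPull`; taken BY NAME (gate lint dedup.landed).

-- `fderiv_fderiv_smul_stPull`: the line restates the tree's `InviscidTop.fderiv_fderiv_smul_stPull`; taken BY NAME (gate lint dedup.landed).

-- `fderiv3_smul_stPull`: the line restates the tree's `FrozenTop.fderiv3_smul_stPull`; taken BY NAME (gate lint dedup.landed).

/-- The third-order datum of a rescaled field. -/
theorem lapD_smul_stPull (a β γ t₀ : ℝ) (x₀ : E3) (ψ : ℝ → E3 → E3) (s : ℝ) (y : E3) :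
    lapD ((a • stPull β γ t₀ x₀ ψ) s) y = (a * γ * γ * γ) • lapD (ψ (t₀ + β * s)) (x₀ + γ • y) := by
  simp only [lapD, FrozenTop.fderiv3_smul_stPull, _root_.smul_apply, Finset.smul_sum]

-- `tendsto_clm_of_tendsto_apply`: the line restates the tree's `InviscidTop.tendsto_clm_of_tendsto_apply`; taken BY NAME (gate lint dedup.landed).

-- `tendsto_fderiv_fderiv_apply_of_bound`: the line restates the tree's `InviscidTop.tendsto_fderiv_fderiv_apply_of_bound`; taken BY NAME (gate lint dedup.landed).

-- `tendsto_fderiv_fderiv_of_bound`: the line restates the tree's `InviscidTop.tendsto_fderiv_fderiv_of_bound`; taken BY NAME (gate lint dedup.landed).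

/-! ### Hessian (`C²_loc`) convergence of Type-I mild sequences (LINE 18's extraction tool) -/

-- `tendsto_fderiv_fderiv_of_typeI_seq_Ioo`: the line restates the tree's `InviscidTop.tendsto_fderiv_fderiv_of_typeI_seq_Ioo`; taken BY NAME (gate lint dedup.landed).

/-! ### Third-order (`C³_loc`) convergence of Type-I mild sequences (LINE 20's extraction tool) -/

-- `tendsto_fderiv3_of_typeI_seq_Ioo`: the line restates the tree's `FrozenTop.tendsto_fderiv3_of_typeI_seq_Ioo`; taken BY NAME (gate lint dedup.landed).

/-- **Convergence of the third-order data** `Σᵢ D³wₖ(t)(x) eᵢ eᵢ → Σᵢ D³W(t)(x) eᵢ eᵢ`. -/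
theorem tendsto_lapD_of_typeI_seq_Ioo {C C' : ℝ} {A : ℕ → ℝ} (hA : Tendsto A atTop atBot)
    {w : ℕ → ℝ → E3 → E3}
    (hc : ∀ k, ContinuousOn (uncurry (w k)) (Ioo (A k) 0 ×ˢ univ))
    (hdivw : ∀ k, ∀ t ∈ Ioo (A k) 0, IsWeaklyDivFree (w k t))
    (hmild : ∀ k, ∀ s t : ℝ, A k < s → s < t → t < 0 → ∀ x,
      w k t x = UnboundedOperators.heatExtension (w k s) (t - s) x - oseenDuhamel 1 s (w k) (w k) t x)
    (hI : ∀ k, ∀ t ∈ Ioo (A k) 0, ∀ x, ‖w k t x‖ ≤ C / Real.sqrt (-t))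
    {W : ℝ → E3 → E3} (hW : IsTypeIAncientMild C' W)
    (hgrad : ∀ t < 0, ∀ x, Tendsto (fun k => fderiv ℝ (w k t) x) atTop (𝓝 (fderiv ℝ (W t) x))) :
    ∀ t < 0, ∀ x, Tendsto (fun k => lapD (w k t) x) atTop (𝓝 (lapD (W t) x)) := by
  intro t ht x
  unfold lapD
  refine tendsto_finsetSum _ fun i _ => ?_
  exact ((ContinuousLinearMap.apply ℝ (E3 →L[ℝ] E3) (eI i)).continuous.tendsto _).comp
    (FrozenTop.tendsto_fderiv3_of_typeI_seq_Ioo hA hc hdivw hmild hI hW hgrad t ht x (eI i))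

/-! ## §3 The singular Type-I zoom package with Hessians and third-order data -/

-- `exists_singularZoom_package₃`: the line restates the tree's `FrozenTop.exists_singularZoom_package₃`; taken BY NAME (gate lint dedup.landed).

/-! ## §4 Fast points of the zoom, and the upgrade of a closed scale-invariant sign condition from `{W ≠ 0}` to
everywhere in `𝒦` (LINE 21 §6 / LINE 22 §5, the parts the integral transfer uses; re-proved verbatim) -/

-- `tendsto_physicalTime`: the line restates the tree's `ColumnarTop.tendsto_physicalTime`; taken BY NAME (gate lint dedup.landed).

-- `sqrt_timeLag`: the line restates the tree's `StretchedTop.sqrt_timeLag`; taken BY NAME (gate lint dedup.landed).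

-- `eventually_fast`: the line restates the tree's `ColumnarTop.eventually_fast`; taken BY NAME (gate lint dedup.landed).

-- `radius_eq`: the line restates the tree's `FrozenTop.radius_eq`; taken BY NAME (gate lint dedup.landed).

-- `forall_of_forall_ne_zero`: the line restates the tree's `StretchedTop.forall_of_forall_ne_zero`; taken BY NAME (gate lint dedup.landed).

-- `lapD_eq_zero_of_eq_zero`: the line restates the tree's `FrozenTop.lapD_eq_zero_of_eq_zero`; taken BY NAME (gate lint dedup.landed).

-- `jointCond_everywhere₆`: the line restates the tree's `FrozenTop.jointCond_everywhere₄`; taken BY NAME (gate lint dedup.landed).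

/-! ## §5 Measurable zoom charts, scale covariance of space–time volume, measurability of the top (LINE 22 §6, the
parts the time-dependent transfer of §7 uses; re-proved verbatim — LINE 22's time-independent `integral_transfer₆`
itself is not needed here and is dropped) -/

/-- The zoom chart `Φ (s, y) = (T + a s, x₀ + b y)` of `ℝ × ℝ³` as a measurable equivalence (`a, b ≠ 0`). -/
def zoomChart (T a : ℝ) (x₀ : E3) (b : ℝ) (ha : a ≠ 0) (hb : b ≠ 0) : ℝ × E3 ≃ᵐ ℝ × E3 :=
  MeasurableEquiv.prodCongr
    (((Homeomorph.mulLeft₀ a ha).trans (Homeomorph.addLeft T)).toMeasurableEquiv)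
    (((Homeomorph.smulOfNeZero b hb).trans (Homeomorph.addLeft x₀)).toMeasurableEquiv)

/-- Unfolding the zoom chart. -/
theorem zoomChart_apply (T a : ℝ) (x₀ : E3) (b : ℝ) (ha : a ≠ 0) (hb : b ≠ 0) (z : ℝ × E3) :
    zoomChart T a x₀ b ha hb z = (T + a * z.1, x₀ + b • z.2) := rfl

/-- The zoom chart as a function. -/
theorem coe_zoomChart (T a : ℝ) (x₀ : E3) (b : ℝ) (ha : a ≠ 0) (hb : b ≠ 0) :
    ⇑(zoomChart T a x₀ b ha hb) = Prod.map (fun s : ℝ => T + a * s) (fun y : E3 => x₀ + b • y) := rfl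

/-- **Scale covariance of space–time volume**: `Φ_* vol = (a b³)⁻¹ vol`. -/
theorem map_zoomChart_volume {T a b : ℝ} {x₀ : E3} (ha : 0 < a) (hb : 0 < b) :
    Measure.map (zoomChart T a x₀ b ha.ne' hb.ne') volume = ENNReal.ofReal (a * b ^ 3)⁻¹ • volume := by
  have h1 : Measure.map (fun s : ℝ => T + a * s) volume = ENNReal.ofReal a⁻¹ • volume := by
    rw [show (fun s : ℝ => T + a * s) = (fun s => T + s) ∘ (fun s => a * s) from rfl,
      ← Measure.map_map (measurable_const_add T) (measurable_const_mul a),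
      Real.map_volume_mul_left ha.ne', Measure.map_smul, map_add_left_eq_self, abs_of_pos (inv_pos.2 ha)]
  have h2 : Measure.map (fun y : E3 => x₀ + b • y) volume = ENNReal.ofReal (b ^ 3)⁻¹ • volume := by
    rw [show (fun y : E3 => x₀ + b • y) = (fun y => x₀ + y) ∘ (fun y => b • y) from rfl,
      ← Measure.map_map (measurable_const_add x₀) (measurable_const_smul b),
      Measure.map_addHaar_smul volume hb.ne', Measure.map_smul, map_add_left_eq_self, finrank_euclideanSpace,
      Fintype.card_fin, abs_of_pos (inv_pos.2 (pow_pos hb 3))]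
  have hf : Measurable fun s : ℝ => T + a * s := (measurable_const_add T).comp (measurable_const_mul a)
  have hg : Measurable fun y : E3 => x₀ + b • y := (measurable_const_add x₀).comp (measurable_const_smul b)
  rw [coe_zoomChart, Measure.volume_eq_prod ℝ E3, ← Measure.map_prod_map _ _ hf hg, h1, h2,
    Measure.prod_smul_left, Measure.prod_smul_right, smul_smul, ← ENNReal.ofReal_mul (inv_nonneg.2 ha.le),
    mul_inv]

/-- `vol(Φ K) = a b³ · vol K`. -/
theorem volume_image_zoomChart {T a b : ℝ} {x₀ : E3} (ha : 0 < a) (hb : 0 < b) (K : Set (ℝ × E3)) :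
    volume (zoomChart T a x₀ b ha.ne' hb.ne' '' K) = ENNReal.ofReal (a * b ^ 3) * volume K := by
  set Φ := zoomChart T a x₀ b ha.ne' hb.ne'
  have h : (volume : Measure (ℝ × E3)).map Φ (Φ '' K) = volume (Φ ⁻¹' (Φ '' K)) :=
    MeasurableEquiv.map_apply Φ _
  rw [Φ.injective.preimage_image, map_zoomChart_volume ha hb, Measure.smul_apply, smul_eq_mul] at h
  have hD : 0 < a * b ^ 3 := by positivity
  calc volume (Φ '' K)
      = ENNReal.ofReal (a * b ^ 3) * (ENNReal.ofReal (a * b ^ 3)⁻¹ * volume (Φ '' K)) := by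
        rw [← mul_assoc, ← ENNReal.ofReal_mul hD.le, mul_inv_cancel₀ hD.ne', ENNReal.ofReal_one, one_mul]
    _ = ENNReal.ofReal (a * b ^ 3) * volume K := by rw [h]

/-- **Change of variables** for set `lintegral`s under the zoom chart: `∫_K F∘Φ = (a b³)⁻¹ ∫_{Φ K} F`
(no measurability of `F` needed). -/
theorem setLIntegral_comp_zoomChart {T a b : ℝ} {x₀ : E3} (ha : 0 < a) (hb : 0 < b) (F : ℝ × E3 → ℝ≥0∞)
    (K : Set (ℝ × E3)) :
    ∫⁻ z in K, F (zoomChart T a x₀ b ha.ne' hb.ne' z) =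
      ENNReal.ofReal (a * b ^ 3)⁻¹ * ∫⁻ z in zoomChart T a x₀ b ha.ne' hb.ne' '' K, F z := by
  set Φ := zoomChart T a x₀ b ha.ne' hb.ne'
  have hmap : Measure.map Φ (volume.restrict K) = ENNReal.ofReal (a * b ^ 3)⁻¹ • volume.restrict (Φ '' K) := by
    have h := Φ.measurableEmbedding.restrict_map volume (Φ '' K)
    rw [Φ.injective.preimage_image] at h
    rw [← h, map_zoomChart_volume ha hb, Measure.restrict_smul]
  rw [← lintegral_map_equiv F Φ, hmap, lintegral_smul_measure, smul_eq_mul]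

/-- `Φ`-pullbacks of an a.e.-measurable function are a.e.-measurable (`Φ_* vol ≪ vol`). -/
theorem aemeasurable_comp_zoomChart {T a b : ℝ} {x₀ : E3} (ha : 0 < a) (hb : 0 < b) {F : ℝ × E3 → ℝ≥0∞}
    (hF : AEMeasurable F volume) : AEMeasurable (fun z => F (zoomChart T a x₀ b ha.ne' hb.ne' z)) volume := by
  refine hF.comp_quasiMeasurePreserving ⟨(zoomChart T a x₀ b ha.ne' hb.ne').measurable, ?_⟩
  rw [map_zoomChart_volume ha hb]
  exact Measure.smul_absolutelyContinuous

-- `continuousOn_quad`: the line restates the tree's `IntegratedStretch.continuousOn_quad`; taken BY NAME (gate lint dedup.landed).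

-- `sqrt_nu_timeLag`: the line restates the tree's `IntegratedStretch.sqrt_nu_timeLag`; taken BY NAME (gate lint dedup.landed).

-- `measurableSet_top`: the line restates the tree's `IntegratedStretch.measurableSet_top`; taken BY NAME (gate lint dedup.landed).

-- `sing_of_not_bounded`: the line restates the tree's `InviscidTop.sing_of_not_bounded`; taken BY NAME (gate lint dedup.landed).

end Summit.NavierStokesRegularity.NavierStokesRegularity.Theorems.ScenarioCensus.LiouvilleSocket

end
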